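import Mathlib

/-!
# Route OverlapGapAlgebra, crux `SearchHardWindow` (stmt-PneNP-2460): the literal-level slot bound
# `stub_slotBound` (line `Sketch`, ensemble OGP of Huang–Sellke 2025, Lemma 3.22)

Replicas `ℓ : Fin (k+1)` with assignments `Y ℓ : Fin n → Bool`, an ADMISSIBLE block-root map `ρ`
(`ρ b ℓ ≤ ℓ`, `ρ b` constant on `[ρ b ℓ, ℓ]`) and a free array of literals
`u : Fin (k+1) → Fin k → Fin n × Bool`: replica `ℓ` sees at position `b` the literal `u (ρ b ℓ) b`,
and `(v, c)` is true under `Y ℓ` iff `Y ℓ v = c`.  `stub_slotBound`: the arrays on which EVERY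
replica sees a true literal number at most `(1 − 2^{−k} (FA / n^s − k(k+1)/2 · 2^{−F})) · #arrays`,
`FA = Σ_ℓ ν_ℓ`, `ν_ℓ = #{I : Fin s → Fin n | (Y ℓ (I r))_r ≠ (Y ℓ' (I r))_r ∀ ℓ' < ℓ}`, `s + F ≤ k`.

Proof (`V ℓ` = "all `k` literals of replica `ℓ` are false under `Y ℓ`"): the complement of the
counted set is `⋃_ℓ V ℓ ⊇ ⨆_ℓ W ℓ`, `W ℓ = V ℓ ∖ ⋃_{ℓ' < ℓ} V ℓ'`, and (`slb_perReplica`)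
`#W ℓ ≥ 2^{−k} #arrays · ν_ℓ / n^s − ℓ · 2^{−k−F} #arrays`: by admissibility the earlier replicas
`ℓ'` differing from `ℓ` in `< F` block roots share with `ℓ` a common set of `≥ s` positions, inside
which we fix `s` darts (`slb_exists_darts`); if `ℓ` is violated and the pattern of `Y ℓ` at the
variables of `ℓ`'s literals on the darts differs from that of every earlier `Y ℓ'` ("newness"), each
such recent `ℓ'` reads, at a dart where the patterns differ, the same literal as `ℓ`, false under
`Y ℓ` hence true under `Y ℓ'`.  So `W ℓ ⊇ (V ℓ ∩ New ℓ) ∖ ⋃_{ℓ' non-recent} (V ℓ ∩ V ℓ')`, where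
`#(V ℓ ∩ New ℓ) · 2^k = #New ℓ` (newness only reads variables; **Counting Lemma 1**
`slb_card_constraints`: prescribing the signs at a set `Q` of coordinates as functions of the
variables cuts out a `2^{-#Q}` fraction, the two halves of one constraint being exchanged by a sign
flip), `#New ℓ · n^s = #arrays · ν_ℓ` (**Counting Lemma 2** `slb_card_proj`: the fibres of the
projection to the variables at `s` distinct coordinates are exchanged by transpositions of values),
and for each of the `≤ ℓ` non-recent `ℓ' < ℓ` the event `V ℓ ∩ V ℓ'` prescribes `≥ k + F` signs.
Summing over `ℓ` (`Σ_ℓ ℓ = k(k+1)/2`) and dividing out concludes.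
-/

set_option linter.dupNamespace false -- `Summit.PneNP.PneNP.…`: summit = sub-problem

namespace Summit.PneNP.PneNP.Theorems

open Finset
open scoped Classical

variable {ι κ α : Type*}

/-- The sign flip at one coordinate `a` of a free array: an involution fixing all variables and all
other coordinates and negating the sign at `a`. -/
theorem slb_exists_flip (a : ι × κ) :
    ∃ f : (ι → κ → α × Bool) → (ι → κ → α × Bool),
      (∀ u, f (f u) = u) ∧ (∀ u i b, (f u i b).1 = (u i b).1) ∧
      (∀ u i b, (i, b) ≠ a → f u i b = u i b) ∧ (∀ u, (f u a.1 a.2).2 = !(u a.1 a.2).2) := by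
  refine ⟨fun u i b => if (i, b) = a then ((u i b).1, !(u i b).2) else u i b, fun u => ?_,
    fun u i b => ?_, fun u i b h => by simp [h], fun u => by simp⟩
  · funext i b
    by_cases h : (i, b) = a <;> simp [h]
  · by_cases h : (i, b) = a <;> simp [h]

/-- **Counting Lemma 1 (sign constraints halve).** If membership in `A` only depends on the
variables and on the signs at coordinates outside `Q`, then the members of `A` whose sign at each
coordinate `q ∈ Q` is a prescribed function `φ q` of the variable at `q` form exactly a
`2^{-#Q}` fraction of `A` (induction on `Q`: a new constraint at `a` splits the set into two halves
exchanged by the sign flip at `a`). -/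
theorem slb_card_constraints (Q : Finset (ι × κ)) (φ : ι × κ → α → Bool)
    (A B : Finset (ι → κ → α × Bool))
    (hA : ∀ u v : ι → κ → α × Bool, (∀ i b, (u i b).1 = (v i b).1) →
      (∀ i b, (i, b) ∉ Q → (u i b).2 = (v i b).2) → (u ∈ A ↔ v ∈ A))
    (hB : ∀ u, u ∈ B ↔ u ∈ A ∧ ∀ q ∈ Q, (u q.1 q.2).2 = φ q (u q.1 q.2).1) :
    #B * 2 ^ #Q = #A := by
  induction Q using Finset.induction_on generalizing A B with
  | empty =>
    have : B = A := by
      ext u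
      simp [hB]
    simp [this]
  | insert a Q haQ ih =>
    obtain ⟨f, hf1, hf2, hf3, hf4⟩ := slb_exists_flip (α := α) a
    obtain ⟨M, hM⟩ : ∃ M : Finset (ι → κ → α × Bool),
        M = A.filter fun u => ∀ q ∈ Q, (u q.1 q.2).2 = φ q (u q.1 q.2).1 := ⟨_, rfl⟩
    have hfA : ∀ u, f u ∈ A ↔ u ∈ A := fun u =>
      hA (f u) u (hf2 u) fun i b hib => by rw [hf3 u i b fun h => hib (h ▸ mem_insert_self a Q)]
    have hfM : ∀ u, f u ∈ M ↔ u ∈ M := by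
      intro u
      simp only [hM, mem_filter, hfA]
      refine and_congr_right fun _ => forall₂_congr fun q hq => ?_
      rw [hf3 u q.1 q.2 fun h => haQ (h ▸ hq)]
    -- the new constraint halves `M`: the two halves are exchanged by `f`
    have h1 : #(M.filter fun u => (u a.1 a.2).2 = φ a (u a.1 a.2).1) = #B := by
      congr 1
      ext u
      rw [mem_filter, hB, hM, mem_filter, forall_mem_insert, and_assoc, and_comm (a := _ = φ a _)]
    have h2 : #(M.filter fun u => ¬ (u a.1 a.2).2 = φ a (u a.1 a.2).1) = #B := by
      rw [← h1]
      refine card_bijective f (Function.Involutive.bijective hf1) fun u => ?_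
      rw [mem_filter, mem_filter, hfM, hf2, hf4, Bool.not_eq]
    have h3 : #M * 2 ^ #Q = #A :=
      ih A M (fun u v h1 h2 => hA u v h1 fun i b hib => h2 i b fun h => hib (mem_insert_of_mem h))
        fun u => by rw [hM, mem_filter]
    rw [card_insert_of_notMem haQ, pow_succ, ← h3, ← card_filter_add_card_filter_not (s := M)
      (fun u => (u a.1 a.2).2 = φ a (u a.1 a.2).1), h1, h2]
    ring

/-- Transposing the variables at the (distinct) coordinates `c r` between `I r` and `I' r`: an
involution of the free arrays exchanging the fibres of the projection above `I` and `I'`. -/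
theorem slb_exists_swap {σ : Type*} [DecidableEq α] (c : σ → ι × κ) (hc : Function.Injective c)
    (I I' : σ → α) :
    ∃ Φ : (ι → κ → α × Bool) → (ι → κ → α × Bool), (∀ u, Φ (Φ u) = u) ∧
      ∀ u r, (Φ u (c r).1 (c r).2).1 = Equiv.swap (I r) (I' r) (u (c r).1 (c r).2).1 := by
  refine ⟨fun u i b => (if h : ∃ r, c r = (i, b) then
      Equiv.swap (I h.choose) (I' h.choose) (u i b).1 else (u i b).1, (u i b).2), ?_, ?_⟩
  · intro u
    funext i b
    by_cases h : ∃ r, c r = (i, b)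
    · simp only [dif_pos h, Equiv.swap_apply_self, Prod.mk.eta]
    · simp only [dif_neg h, Prod.mk.eta]
  · intro u r
    have h : ∃ r', c r' = ((c r).1, (c r).2) := ⟨r, rfl⟩
    have hr : h.choose = r := hc h.choose_spec
    simp only [dif_pos h, hr]

/-- **Counting Lemma 2 (the variables at distinct coordinates are independent and uniform).** For
an injective family `c` of coordinates, the arrays whose tuple of variables at `c` lies in `B`
number `#B · #arrays / #tuples` (all fibres of the projection have the same size). -/
theorem slb_card_proj {σ : Type*} [Fintype σ] [DecidableEq σ] [Fintype ι] [DecidableEq ι]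
    [Fintype κ] [DecidableEq κ] [Fintype α] [DecidableEq α]
    (c : σ → ι × κ) (hc : Function.Injective c) (A : Finset (ι → κ → α × Bool))
    (B : Finset (σ → α)) (hAB : ∀ u, u ∈ A ↔ (fun r => (u (c r).1 (c r).2).1) ∈ B) :
    #A * Fintype.card (σ → α) = Fintype.card (ι → κ → α × Bool) * #B := by
  obtain ⟨pr, hpr⟩ : ∃ pr : (ι → κ → α × Bool) → σ → α,
      ∀ u, pr u = fun r => (u (c r).1 (c r).2).1 := ⟨_, fun u => rfl⟩
  simp only [← hpr] at hAB
  have hfib : ∀ I I', #(univ.filter fun u => pr u = I) = #(univ.filter fun u => pr u = I') := by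
    intro I I'
    obtain ⟨Φ, hΦ1, hΦ2⟩ := slb_exists_swap c hc I I'
    refine card_bijective Φ (Function.Involutive.bijective hΦ1) fun u => ?_
    simp only [mem_filter, mem_univ, true_and, hpr, funext_iff, hΦ2]
    refine forall_congr' fun r => ?_
    rw [Equiv.apply_eq_iff_eq_symm_apply, Equiv.symm_swap, Equiv.swap_apply_right]
  have hsum : ∀ I, #(univ.filter fun u => pr u = I) * Fintype.card (σ → α) =
      Fintype.card (ι → κ → α × Bool) := by
    intro I
    have h := card_eq_sum_card_fiberwise (f := pr) (s := univ) (t := univ) fun u _ => mem_univ _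
    rw [sum_congr rfl fun I' _ => hfib I' I, sum_const, smul_eq_mul, card_univ, card_univ] at h
    rw [h, mul_comm]
  rw [card_eq_sum_card_fiberwise (f := pr) (s := A) (t := B) fun u hu => (hAB u).1 hu, sum_mul]
  have hfibA : ∀ I ∈ B, #(A.filter fun u => pr u = I) * Fintype.card (σ → α) =
      Fintype.card (ι → κ → α × Bool) := by
    intro I hI
    rw [← hsum I]
    congr 2
    ext u
    simp only [mem_filter, mem_univ, true_and, and_iff_right_iff_imp]
    exact fun h => (hAB u).2 (h ▸ hI)
  rw [sum_congr rfl hfibA, sum_const, smul_eq_mul, mul_comm]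

/-- **The key set of an admissible block-root map.** For `ρ` admissible (`ρ b ℓ ≤ ℓ`, and `ρ b`
constant on `[ρ b ℓ, ℓ]`) and `s + F ≤ k`, every replica `ℓ` admits `s` distinct positions
`t r : Fin k` at which EVERY earlier replica `ℓ' < ℓ` differing from `ℓ` in fewer than `F` block
roots has the same block root as `ℓ` (these recent earlier replicas form an interval `[ℓ₀, ℓ)`, and
the `≥ k − F + 1 > s` positions where `ℓ₀` agrees with `ℓ` work for all of them). -/
theorem slb_exists_darts (k s F : ℕ) (hsF : s + F ≤ k) (ρ : Fin k → Fin (k + 1) → Fin (k + 1))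
    (hρ1 : ∀ b ℓ, ρ b ℓ ≤ ℓ) (hρ2 : ∀ b ℓ ℓ', ρ b ℓ ≤ ℓ' → ℓ' ≤ ℓ → ρ b ℓ' = ρ b ℓ)
    (ℓ : Fin (k + 1)) :
    ∃ t : Fin s → Fin k, Function.Injective t ∧ ∀ r (ℓ' : Fin (k + 1)), ℓ' < ℓ →
      #(univ.filter fun b => ρ b ℓ' ≠ ρ b ℓ) < F → ρ (t r) ℓ' = ρ (t r) ℓ := by
  -- the recent earlier replicas `Rc` and the key set `C`, of cardinality `≥ s`
  obtain ⟨Rc, hRc⟩ : ∃ Rc : Finset (Fin (k + 1)),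
      ∀ ℓ', ℓ' ∈ Rc ↔ ℓ' < ℓ ∧ #(univ.filter fun b => ρ b ℓ' ≠ ρ b ℓ) < F :=
    ⟨univ.filter _, fun ℓ' => mem_filter.trans (and_iff_right (mem_univ _))⟩
  obtain ⟨C, hC⟩ : ∃ C : Finset (Fin k), ∀ b, b ∈ C ↔ ∀ ℓ' ∈ Rc, ρ b ℓ' = ρ b ℓ :=
    ⟨univ.filter _, fun b => mem_filter.trans (and_iff_right (mem_univ _))⟩
  have hsC : s ≤ #C := by
    rcases Rc.eq_empty_or_nonempty with h | h
    · rw [show C = univ from eq_univ_of_forall fun b => (hC b).2 (by simp [h]), card_univ,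
        Fintype.card_fin]
      omega
    · have h0 := ((hRc _).1 (min'_mem Rc h)).2
      have hsub : (univ.filter fun b => ρ b (Rc.min' h) = ρ b ℓ) ⊆ C := by
        refine fun b hb => (hC b).2 fun ℓ' hℓ' => hρ2 b ℓ ℓ' ?_ ((hRc _).1 hℓ').1.le
        exact (mem_filter.1 hb).2 ▸ (hρ1 b _).trans (min'_le Rc ℓ' hℓ')
      have hcard := card_filter_add_card_filter_not (s := (univ : Finset (Fin k)))
        (fun b => ρ b (Rc.min' h) = ρ b ℓ)
      rw [card_univ, Fintype.card_fin] at hcard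
      have := card_le_card hsub
      simp only [ne_eq] at h0
      omega
  -- choose `s` darts inside `C`
  refine ⟨fun r => (C.equivFin.symm (Fin.castLE hsC r)).1, fun r r' h =>
    Fin.castLE_injective hsC (C.equivFin.symm.injective (Subtype.val_injective h)),
    fun r ℓ' hlt hF => ?_⟩
  exact (hC _).1 (C.equivFin.symm (Fin.castLE hsC r)).2 ℓ' ((hRc _).2 ⟨hlt, hF⟩)

/-- **Per-replica bound.** For each replica `ℓ`, in cleared-denominator natural-number form:
`#arrays · ν_ℓ · 2^F ≤ (#W ℓ · 2^{k+F} + ℓ · #arrays) · n^s`, where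
`W ℓ = {u | ℓ violated, no earlier replica violated}`. -/
theorem slb_perReplica (n k s F : ℕ) (hsF : s + F ≤ k) (Y : Fin (k + 1) → Fin n → Bool)
    (ρ : Fin k → Fin (k + 1) → Fin (k + 1)) (hρ1 : ∀ b ℓ, ρ b ℓ ≤ ℓ)
    (hρ2 : ∀ b ℓ ℓ', ρ b ℓ ≤ ℓ' → ℓ' ≤ ℓ → ρ b ℓ' = ρ b ℓ) (ℓ : Fin (k + 1)) :
    Fintype.card (Fin (k + 1) → Fin k → Fin n × Bool) *
          #(univ.filter fun I : Fin s → Fin n =>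
            ∀ ℓ' : Fin (k + 1), ℓ' < ℓ → ¬ ∀ r, Y ℓ (I r) = Y ℓ' (I r)) * 2 ^ F ≤
      (#(univ.filter fun u : Fin (k + 1) → Fin k → Fin n × Bool =>
            (∀ b, Y ℓ (u (ρ b ℓ) b).1 ≠ (u (ρ b ℓ) b).2) ∧
              ∀ ℓ' : Fin (k + 1), ℓ' < ℓ → ¬ ∀ b, Y ℓ' (u (ρ b ℓ') b).1 ≠ (u (ρ b ℓ') b).2) *
          2 ^ (k + F) +
        (ℓ : ℕ) * Fintype.card (Fin (k + 1) → Fin k → Fin n × Bool)) * n ^ s := by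
  obtain ⟨t, ht, hkey⟩ := slb_exists_darts k s F hsF ρ hρ1 hρ2 ℓ
  set N := Fintype.card (Fin (k + 1) → Fin k → Fin n × Bool)
  set W := univ.filter fun u : Fin (k + 1) → Fin k → Fin n × Bool =>
      (∀ b, Y ℓ (u (ρ b ℓ) b).1 ≠ (u (ρ b ℓ) b).2) ∧
        ∀ ℓ' : Fin (k + 1), ℓ' < ℓ → ¬ ∀ b, Y ℓ' (u (ρ b ℓ') b).1 ≠ (u (ρ b ℓ') b).2
  set Bν := univ.filter fun I : Fin s → Fin n =>
      ∀ ℓ' : Fin (k + 1), ℓ' < ℓ → ¬ ∀ r, Y ℓ (I r) = Y ℓ' (I r) with hBνdef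
  -- newness (patterns read at the variables of `ℓ`'s literals on the darts), violation ∧ newness,
  -- the non-recent earlier replicas, joint violations
  obtain ⟨NewS, hNewS⟩ : ∃ NewS : Finset (Fin (k + 1) → Fin k → Fin n × Bool), ∀ u, u ∈ NewS ↔
      ∀ ℓ' : Fin (k + 1), ℓ' < ℓ →
        ¬ ∀ r, Y ℓ (u (ρ (t r) ℓ) (t r)).1 = Y ℓ' (u (ρ (t r) ℓ) (t r)).1 :=
    ⟨univ.filter _, fun u => mem_filter.trans (and_iff_right (mem_univ _))⟩
  obtain ⟨VN, hVN⟩ : ∃ VN : Finset (Fin (k + 1) → Fin k → Fin n × Bool), ∀ u, u ∈ VN ↔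
      u ∈ NewS ∧ ∀ b, Y ℓ (u (ρ b ℓ) b).1 ≠ (u (ρ b ℓ) b).2 :=
    ⟨NewS.filter _, fun u => mem_filter⟩
  obtain ⟨NR, hNR⟩ : ∃ NR : Finset (Fin (k + 1)), ∀ ℓ', ℓ' ∈ NR ↔
      ℓ' < ℓ ∧ F ≤ #(univ.filter fun b => ρ b ℓ' ≠ ρ b ℓ) :=
    ⟨univ.filter _, fun ℓ' => mem_filter.trans (and_iff_right (mem_univ _))⟩
  obtain ⟨VV, hVV⟩ : ∃ VV : Fin (k + 1) → Finset (Fin (k + 1) → Fin k → Fin n × Bool), ∀ ℓ' u,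
      u ∈ VV ℓ' ↔ (∀ b, Y ℓ (u (ρ b ℓ) b).1 ≠ (u (ρ b ℓ) b).2) ∧
        ∀ b, Y ℓ' (u (ρ b ℓ') b).1 ≠ (u (ρ b ℓ') b).2 :=
    ⟨fun ℓ' => univ.filter _, fun ℓ' u => mem_filter.trans (and_iff_right (mem_univ _))⟩
  -- (3) Claim A: violation + newness ⇒ no recent earlier replica is violated
  have h3 : #VN ≤ #W + ∑ ℓ' ∈ NR, #(VV ℓ') := by
    refine (card_le_card fun u hu => ?_).trans
      ((card_union_le _ _).trans (Nat.add_le_add_left card_biUnion_le _))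
    obtain ⟨hNew, hV⟩ := (hVN u).1 hu
    rw [hNewS] at hNew
    rw [mem_union, mem_biUnion]
    by_cases hnr : ∃ ℓ' ∈ NR, ∀ b, Y ℓ' (u (ρ b ℓ') b).1 ≠ (u (ρ b ℓ') b).2
    · obtain ⟨ℓ', hℓ', hV'⟩ := hnr
      exact Or.inr ⟨ℓ', hℓ', (hVV ℓ' u).2 ⟨hV, hV'⟩⟩
    · push Not at hnr
      refine Or.inl (mem_filter.2 ⟨mem_univ _, hV, fun ℓ' hlt hV' => ?_⟩)
      by_cases hFle : F ≤ #(univ.filter fun b => ρ b ℓ' ≠ ρ b ℓ)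
      · obtain ⟨b, hb⟩ := hnr ℓ' ((hNR ℓ').2 ⟨hlt, hFle⟩)
        exact hV' b hb
      · obtain ⟨r, hr⟩ := not_forall.1 (hNew ℓ' hlt)
        have h2 := hV' (t r)
        rw [hkey r ℓ' hlt (not_le.1 hFle)] at h2
        exact hr ((Bool.eq_not_iff.2 (hV (t r))).trans (Bool.eq_not_iff.2 h2).symm)
  -- (4) joint violation with a non-recent replica prescribes `≥ k + F` signs
  have h4 : ∀ ℓ' ∈ NR, #(VV ℓ') * 2 ^ (k + F) ≤ N := by
    intro ℓ' hℓ'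
    obtain ⟨-, hF⟩ := (hNR ℓ').1 hℓ'
    set D := univ.filter fun b => ρ b ℓ' ≠ ρ b ℓ
    have hD : ∀ b, b ∈ D ↔ ρ b ℓ' ≠ ρ b ℓ := fun b => mem_filter.trans (and_iff_right (mem_univ _))
    have hdisj : Disjoint (univ.image fun b => (ρ b ℓ, b)) (D.image fun b => (ρ b ℓ', b)) := by
      refine disjoint_left.2 fun q hq hq' => ?_
      obtain ⟨b, -, rfl⟩ := mem_image.1 hq
      obtain ⟨b', hb', he⟩ := mem_image.1 hq'
      obtain ⟨h1, rfl⟩ := Prod.mk.inj he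
      exact (hD _).1 hb' h1
    obtain ⟨Q, hQdef⟩ : ∃ Q : Finset (Fin (k + 1) × Fin k),
        Q = univ.image (fun b => (ρ b ℓ, b)) ∪ D.image (fun b => (ρ b ℓ', b)) := ⟨_, rfl⟩
    have hcardQ : k + F ≤ #Q := by
      rw [hQdef, card_union_of_disjoint hdisj,
        card_image_of_injective _ (fun b b' h => congrArg Prod.snd h),
        card_image_of_injective _ (fun b b' h => congrArg Prod.snd h), card_univ, Fintype.card_fin]
      omega
    obtain ⟨φ, hφ⟩ : ∃ φ : Fin (k + 1) × Fin k → Fin n → Bool,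
        ∀ q v, φ q v = if q.1 = ρ q.2 ℓ then !(Y ℓ v) else !(Y ℓ' v) := ⟨_, fun q v => rfl⟩
    obtain ⟨Bc, hBc⟩ : ∃ Bc : Finset (Fin (k + 1) → Fin k → Fin n × Bool), ∀ u, u ∈ Bc ↔
        ∀ q ∈ Q, (u q.1 q.2).2 = φ q (u q.1 q.2).1 :=
      ⟨univ.filter _, fun u => mem_filter.trans (and_iff_right (mem_univ _))⟩
    have hcount : #Bc * 2 ^ #Q = N :=
      (slb_card_constraints Q φ univ Bc (fun u v _ _ => iff_of_true (mem_univ u) (mem_univ v))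
        fun u => by rw [hBc u, and_iff_right (mem_univ u)]).trans card_univ
    have hsub : VV ℓ' ⊆ Bc := by
      intro u hu
      obtain ⟨hV, hV'⟩ := (hVV ℓ' u).1 hu
      refine (hBc u).2 fun q hq => ?_
      rcases mem_union.1 (hQdef ▸ hq) with hq | hq
      · obtain ⟨b, -, rfl⟩ := mem_image.1 hq
        rw [hφ, if_pos rfl]
        exact Bool.eq_not_iff.2 (hV b).symm
      · obtain ⟨b, hb, rfl⟩ := mem_image.1 hq
        rw [hφ, if_neg ((hD b).1 hb)]
        exact Bool.eq_not_iff.2 (hV' b).symm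
    calc #(VV ℓ') * 2 ^ (k + F) ≤ #Bc * 2 ^ #Q :=
          Nat.mul_le_mul (card_le_card hsub) (Nat.pow_le_pow_right (by norm_num) hcardQ)
      _ = N := hcount
  -- (5) violation of `ℓ` prescribes `k` signs, newness only reads variables
  have h5 : #VN * 2 ^ k = #NewS := by
    obtain ⟨Q₀, hQ₀def⟩ : ∃ Q₀ : Finset (Fin (k + 1) × Fin k),
        Q₀ = univ.image fun b => (ρ b ℓ, b) := ⟨_, rfl⟩
    have hcardQ₀ : #Q₀ = k := by
      rw [hQ₀def, card_image_of_injective _ (fun b b' h => congrArg Prod.snd h), card_univ,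
        Fintype.card_fin]
    have h := slb_card_constraints Q₀ (fun _ v => !(Y ℓ v)) NewS VN
      (fun u v h1 _ => by rw [hNewS, hNewS]; simp only [h1]) fun u => by
      rw [hVN, hQ₀def, forall_mem_image]
      refine and_congr_right fun _ => ?_
      simp only [mem_univ, true_implies]
      exact forall_congr' fun b => ne_comm.trans Bool.eq_not_iff.symm
    rwa [hcardQ₀] at h
  -- (6) the variables on the darts are uniform
  have h6 : #NewS * n ^ s = N * #Bν := by
    have h := slb_card_proj (fun r => (ρ (t r) ℓ, t r)) (fun r r' h => ht (congrArg Prod.snd h))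
      NewS Bν fun u => by rw [hNewS, hBνdef, mem_filter, and_iff_right (mem_univ _)]
    have hns : Fintype.card (Fin s → Fin n) = n ^ s := by simp
    rwa [hns] at h
  -- (7) at most `ℓ` non-recent earlier replicas; assemble
  have h7 : #NR ≤ ℓ :=
    (card_le_card fun x hx => mem_Iio.2 ((hNR x).1 hx).1).trans (Fin.card_Iio ℓ).le
  have h47 : (∑ ℓ' ∈ NR, #(VV ℓ')) * 2 ^ (k + F) ≤ ℓ * N :=
    calc (∑ ℓ' ∈ NR, #(VV ℓ')) * 2 ^ (k + F) = ∑ ℓ' ∈ NR, #(VV ℓ') * 2 ^ (k + F) := sum_mul ..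
      _ ≤ ∑ ℓ' ∈ NR, N := sum_le_sum h4
      _ ≤ ℓ * N := by rw [sum_const, smul_eq_mul]; exact Nat.mul_le_mul_right _ h7
  calc N * #Bν * 2 ^ F = #VN * 2 ^ (k + F) * n ^ s := by rw [← h6, ← h5, pow_add]; ring
    _ ≤ (#W + ∑ ℓ' ∈ NR, #(VV ℓ')) * 2 ^ (k + F) * n ^ s := by gcongr
    _ = (#W * 2 ^ (k + F) + (∑ ℓ' ∈ NR, #(VV ℓ')) * 2 ^ (k + F)) * n ^ s := by ring
    _ ≤ (#W * 2 ^ (k + F) + ℓ * N) * n ^ s := by gcongr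

/-- **STUB G — the literal-level slot bound.** For an admissible block-root map `ρ` and
assignments `Y 0, …, Y k`, among all free arrays `u : Fin (k+1) → Fin k → Fin n × Bool` (literal of
position `b` seen by replica `ℓ` = `u (ρ b ℓ) b`, `(v, c)` true under `Y ℓ` iff `Y ℓ v = c`) the
number on which EVERY replica sees a true literal is at most
`(1 − 2^{−k} (FA_s(Y)/n^s − k(k+1)/2 · 2^{−F})) · #arrays`, `s + F ≤ k`. -/
theorem stub_slotBound (n k s F : ℕ) (hn : 1 ≤ n) (hsF : s + F ≤ k)
    (Y : Fin (k + 1) → Fin n → Bool) (ρ : Fin k → Fin (k + 1) → Fin (k + 1))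
    (hρ1 : ∀ b ℓ, ρ b ℓ ≤ ℓ) (hρ2 : ∀ b ℓ ℓ', ρ b ℓ ≤ ℓ' → ℓ' ≤ ℓ → ρ b ℓ' = ρ b ℓ) :
    ((univ.filter fun u : Fin (k + 1) → Fin k → Fin n × Bool =>
        ∀ ℓ : Fin (k + 1), ∃ b : Fin k, Y ℓ (u (ρ b ℓ) b).1 = (u (ρ b ℓ) b).2).card : ℝ) ≤
      (1 - (1 / 2 : ℝ) ^ k *
          ((∑ ℓ : Fin (k + 1), ((univ.filter fun I : Fin s → Fin n =>
              ∀ ℓ' : Fin (k + 1), ℓ' < ℓ → ¬ ∀ r, Y ℓ (I r) = Y ℓ' (I r)).card : ℝ)) / (n : ℝ) ^ s -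
            (k : ℝ) * (k + 1) / 2 * (1 / 2 : ℝ) ^ F)) *
        Fintype.card (Fin (k + 1) → Fin k → Fin n × Bool) := by
  -- the per-replica bounds, summed
  have h3 := sum_le_sum fun ℓ (_ : ℓ ∈ (univ : Finset (Fin (k + 1)))) =>
    slb_perReplica n k s F hsF Y ρ hρ1 hρ2 ℓ
  rw [← sum_mul, ← mul_sum, ← sum_mul, sum_add_distrib, ← sum_mul, ← sum_mul] at h3
  rw [← Nat.cast_sum]
  set N := Fintype.card (Fin (k + 1) → Fin k → Fin n × Bool)
  set S := #(univ.filter fun u : Fin (k + 1) → Fin k → Fin n × Bool =>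
      ∀ ℓ : Fin (k + 1), ∃ b : Fin k, Y ℓ (u (ρ b ℓ) b).1 = (u (ρ b ℓ) b).2) with hS
  set FA := ∑ ℓ : Fin (k + 1), #(univ.filter fun I : Fin s → Fin n =>
      ∀ ℓ' : Fin (k + 1), ℓ' < ℓ → ¬ ∀ r, Y ℓ (I r) = Y ℓ' (I r))
  -- `Bad` = some replica is violated (the complement of the counted set) contains the pairwise
  -- disjoint sets `W ℓ` (greedy disjointification)
  set Bad := univ.filter fun u : Fin (k + 1) → Fin k → Fin n × Bool =>
      ¬ ∀ ℓ : Fin (k + 1), ∃ b : Fin k, Y ℓ (u (ρ b ℓ) b).1 = (u (ρ b ℓ) b).2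
  have h2 : S + #Bad = N := by
    rw [hS, card_filter_add_card_filter_not, card_univ]
  have h1 : ∑ ℓ : Fin (k + 1), #(univ.filter fun u : Fin (k + 1) → Fin k → Fin n × Bool =>
      (∀ b, Y ℓ (u (ρ b ℓ) b).1 ≠ (u (ρ b ℓ) b).2) ∧
        ∀ ℓ' : Fin (k + 1), ℓ' < ℓ → ¬ ∀ b, Y ℓ' (u (ρ b ℓ') b).1 ≠ (u (ρ b ℓ') b).2) ≤ #Bad := by
    rw [← card_biUnion]
    · refine card_le_card fun u hu => ?_
      obtain ⟨ℓ, -, hℓ⟩ := mem_biUnion.1 hu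
      refine mem_filter.2 ⟨mem_univ _, fun hall => ?_⟩
      obtain ⟨b, hb⟩ := hall ℓ
      exact (mem_filter.1 hℓ).2.1 b hb
    · intro ℓ _ ℓ' _ hne
      simp only [Function.onFun, disjoint_left]
      intro u hu hu'
      rcases lt_or_gt_of_ne hne with h | h
      · exact (mem_filter.1 hu').2.2 ℓ h (mem_filter.1 hu).2.1
      · exact (mem_filter.1 hu).2.2 ℓ' h (mem_filter.1 hu').2.1
  -- the cleared-denominator inequality; divide out
  have hgauss : (∑ ℓ : Fin (k + 1), (ℓ : ℕ)) * 2 = k * (k + 1) := by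
    rw [Fin.sum_univ_eq_sum_range (fun i => i) (k + 1), sum_range_id_mul_two]
    simp [mul_comm]
  have hnat : 2 * N * FA * 2 ^ F + 2 * S * 2 ^ (k + F) * n ^ s ≤
      2 * N * 2 ^ (k + F) * n ^ s + k * (k + 1) * N * n ^ s := by
    have e1 := congrArg (· * (2 ^ (k + F) * n ^ s)) h2
    have e2 := congrArg (· * (N * n ^ s)) hgauss
    nlinarith [h3, h1, e1, e2, Nat.zero_le (2 ^ (k + F) * n ^ s)]
  have key : (2 : ℝ) * N * FA * 2 ^ F + 2 * S * 2 ^ (k + F) * (n : ℝ) ^ s ≤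
      2 * N * 2 ^ (k + F) * (n : ℝ) ^ s + k * (k + 1) * N * (n : ℝ) ^ s := by exact_mod_cast hnat
  have hz : (0 : ℝ) < (n : ℝ) ^ s := by positivity
  rw [← sub_nonneg, show (1 - (1 / 2 : ℝ) ^ k * (FA / (n : ℝ) ^ s - (k : ℝ) * (k + 1) / 2 *
      (1 / 2 : ℝ) ^ F)) * N - S = (1 / 2 : ℝ) ^ k * (1 / 2) ^ F / (2 * (n : ℝ) ^ s) *
      (2 * N * 2 ^ (k + F) * (n : ℝ) ^ s + k * (k + 1) * N * (n : ℝ) ^ s -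
        (2 * N * FA * 2 ^ F + 2 * S * 2 ^ (k + F) * (n : ℝ) ^ s)) by
    simp only [one_div, inv_pow]; field_simp; ring]
  exact mul_nonneg (by positivity) (by linarith)

end Summit.PneNP.PneNP.Theorems
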